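import Summits.QuantumFields.BalabanUV.Beta.GAN24.FineReadoutSecondDiffSymbol

/-!
# `BalabanUV.Beta.GAN24.FineReadoutSecondDiff` — binder row G-an2-4 / (CONV-C), route of record «QR-LL» (OWNER `gan24-p1` g25/g26, `QR-DESIGN-v0.md`; row (LT)
# «LAYER TRANSPORT», leaf-01's (F) `LayerPushMoments` / (G)), THE LOCATED INPUT (N1″) IN THE FORM THAT EXISTS — PART 1b: **TWO DIFFERENCES ON THE MINIMISER LEG
# GAIN `N^{−3/2}` (NOT `N^{−2}`) IN THE FIBRE, UNIFORMLY** — the alias-side form (U2‴), E3A5's twin (`FineReadoutGradient` = one difference, one `1/N`)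

NOT IN PRINT; OUR PROOF ATTEMPT (of the road; THIS file is [folklore] bookkeeping on top of leaf-16's E3A2∕E3A3∕E3A5 and PART 1a `FineReadoutSecondDiffSymbol`: the
two-step difference symbol of each alias costs `(10·Fsup m/N)^{3/2}`, so E3A2's amplitude bound lands in King's `alias_sum_le` at `α = 1/2` and `α = −1/2`
(`AliasPointSum.sum_pointWeight_srep_le` BY NAME) and contributes `N^{−3/2}`).  WHY NOT `N^{−2}`: see PART 1a's header (King at `α = 1` diverges; position side the expected
`log N` of the mixed second differences at block edges — continuum corner computation + scalar toy kit j153041, not a theorem about `wH`; OWNER RULING R-gan24p1-g26-3).  The position-space packaging (Paley–Wiener on the block label, every level from road P1's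
(U1)+A BY NAME, the `respStep` contour smear) is the sequel `GAN24/FineReadoutSecondDiffDecay` ∕ `GAN24/RespStepSecondDiff`.
HONEST FRAMING (cell contract, verbatim): «discharging `BetaPertH` makes Bałaban's UV stability UNCONDITIONAL — a real constructive-QFT result; it is NOT the
continuum limit and NOT the Clay problem.»  HONEST DEPENDENCY (verbatim): «continuum YM on T⁴ ⇐ BetaPertH ∧ nine spine estimates (0/9 proved); BetaPertH ⇐ (D1) ∧
(D4) ∧ CAP+tail; G-an2-4 gates asym, D1 and NE2/3/4.»  (U1)+A are HYPOTHESES here; no cited fact, no wall binder, no `def`, no `def … : Prop`; discharges NOTHING of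
(LT) ∕ (Q-R) ∕ (Q-L) ∕ (C) ∕ «T2Shape» ∕ (hW, hWall); NEVER «G-an2-4 closed» as (CONV-C); NOT D1, NOT `BetaPertH`, NOT continuum, NOT Clay.

## What is proved (generic `d`, `D = d+1`; strip `|Re p_i| ≤ π`, `|Im p_i| ≤ η`, `0 ≤ η ≤ 1/4`, `(3D/2+2)η ≤ 1/2`; `det F_N(p) ≠ 0`; radii `0 < r m`, `0 < r₀`;
## `S_{bc} = √‖b‖₁·‖c‖₁·e^{(η/N)(‖b‖₁+‖c‖₁)}` for the pair of integer steps `b, c`)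
* §4 **`norm_diff2_mul_Asol_border_le`** (`m ≠ 0`): `‖(pw k_m b − 1)(pw k_m c − 1)·Asol…κ‖ ≤ 40√10·K_D·S_{bc}·(N·√N)·(Φ·√F/F + Cc·√F/F²)·Π wfold` — three half-powers
  of `F` and of `N` LESS than E3A2.
* §5 **`norm_sum_ampA_diff2_pw_le`** — (U2‴): for the column `v = F_N(p)⁻¹ e_{(Q,l)}`,
  `‖Σ_m ampA p v m κ · (pw k_m b − 1)(pw k_m c − 1) · pw k_m (repZ z)‖ ≤ e^{(d+1)η}·A·(N^{d+2})⁻¹·(N·√N)⁻¹·4·S_{bc}·((π+1)√(π+1) + 10√10·K_D·(r₀²·C_{1/2} + r₀³·C_{−1/2}))`,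
  `C_α = (3π)^{1−α}·3^D·aliasConst D α` — uniform in `N`, `p`, `κ`, `l`, `z`, `b`, `c`.
Unit `b2b-balaban-gan24-formalise-leaf-02` (G-an2-4 formalisation swarm, leaf prover 02, gen 54; INTENT I-leaf02-g54-1 «N1-TAYLOR», journal l.40624), 2026-08-22.
-/

noncomputable section

open Complex Finset Matrix
open scoped BigOperators Real Matrix.Norms.L2Operator
open Literature.Probability.LatticeModels (TorusSite)
open Literature.MathematicalPhysics.QuantumFieldTheory.LatticeForm (repZ)
open Literature.MathematicalPhysics.QuantumFieldTheory.Balaban1983to89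
open Literature.MathematicalPhysics.QuantumFieldTheory.Balaban1983to89.Beta
open Literature.MathematicalPhysics.QuantumFieldTheory.King1986 (aliasConst)
open B12Sec2to5 (l1 l1_nonneg)
open B4Strip (reVec)
open AffineAveraging (Site)
open BlochFibreMatrix (Idx stencil pieceMatrix)
open FibreInverseDecay (trigPolySymbol)
open Summit.QuantumFields.BalabanUV.Beta.GAN24.FibreSymbols (pw)
open Summit.QuantumFields.BalabanUV.Beta.GAN24.FibreBlockSolve (Asol)
open Summit.QuantumFields.BalabanUV.Beta.GAN24.FibreDFT (kFine)
open Summit.QuantumFields.BalabanUV.Beta.GAN24.FibreDFTDictionary (ampA)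
open Summit.QuantumFields.BalabanUV.Beta.GAN24.AliasObjects (chiAl sbAl dAl dbAl LAl)
open Summit.QuantumFields.BalabanUV.Beta.GAN24.AliasReindex (srep shiftZ repZ_eq_srep_add)
open Summit.QuantumFields.BalabanUV.Beta.GAN24.ArrowOperator (arrowMat)
open Summit.QuantumFields.BalabanUV.Beta.GAN24.ArrowScaling (scaledArrow)
open Summit.QuantumFields.BalabanUV.Beta.GAN24.CombesThomasFibre (fibInv)
open Summit.QuantumFields.BalabanUV.Beta.GAN24.AliasPointSum (realVec pointWeight pointWeight_nonneg sum_pointWeight_srep_le)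
open Summit.QuantumFields.BalabanUV.Beta.GAN24.FineReadoutAlias (wfold Fsup wfold_nonneg one_le_Fsup lapR_pos half_lapR_le_norm_LAl norm_Asol_border_le)
open Summit.QuantumFields.BalabanUV.Beta.GAN24.FineReadoutApriori (column_apriori)
open Summit.QuantumFields.BalabanUV.Beta.GAN24.FineReadoutSum (norm_pw_repZ_le ampA_eq_Asol)
open Summit.QuantumFields.BalabanUV.Beta.GAN24.FineReadoutGradient (abs_srep_le_Fsup)

open Summit.QuantumFields.BalabanUV.Beta.GAN24.FineReadoutSecondDiffSymbol (norm_pw_sub_one_mul_pw_sub_one_le norm_pw_sub_one_mul_pw_sub_one_zero_le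
  pointWeight_half_eq pointWeight_neg_half_eq div_mul_sqrt_div mul_mul_sqrt_mul)

namespace Summit.QuantumFields.BalabanUV.Beta.GAN24.FineReadoutSecondDiff

variable {d N : ℕ} [NeZero N] {p : Fin (d + 1) → ℂ} {η : ℝ}

/-! ## §4 The two-step difference of the border-fed block solution: three half-powers of `F` and of `N` less -/

/-- [folklore] **TWO DIFFERENCES ON THE LEG, PER ALIAS** (`m ≠ 0`):
`‖(pw k_m b − 1)(pw k_m c − 1) · Asol…κ‖ ≤ 40√10·K_D·S_{bc}·(N·√N)·(Φ·√F/F + Cc·√F/F²)·Π wfold`, `S_{bc} = √‖b‖₁·‖c‖₁·e^{(η/N)(‖b‖₁+‖c‖₁)}`. -/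
theorem norm_diff2_mul_Asol_border_le (hre : ∀ i, |(p i).re| ≤ π) (him : ∀ i, |(p i).im| ≤ η) (hη : 0 ≤ η) (hη4 : η ≤ 1 / 4)
    (hηD : (3 * (d + 1 : ℕ) / 2 + 2) * η ≤ 1 / 2) {m : TorusSite (d + 1) N} (hm : m ≠ 0) {φ : Fin (d + 1) → ℂ} {c₀ : ℂ} {Φ Cc : ℝ}
    (hΦ : ∀ l, ‖φ l‖ ≤ Φ) (hCc : ‖c₀‖ ≤ Cc) (κ : Fin (d + 1)) (b c : Site (d + 1)) :
    ‖(pw (kFine p m) b - 1) * (pw (kFine p m) c - 1) *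
        Asol (dAl N p m) (dbAl N p m) (fun l => chiAl N p m * sbAl N p m l * φ l) (LAl N p m) (chiAl N p m * c₀) κ‖
      ≤ 40 * Real.sqrt 10 * (Real.sqrt 12 ^ (d + 1) * (Real.sqrt 6 * (1 + 8 * (d + 1 : ℕ))))
          * (Real.sqrt (l1 b) * l1 c * Real.exp (η / N * (l1 b + l1 c)))
          * ((N : ℝ) * Real.sqrt N) * (Φ * (Real.sqrt (Fsup m) / Fsup m) + Cc * (Real.sqrt (Fsup m) / Fsup m ^ 2)) * ∏ i, wfold m i := by
  have hN : (0 : ℝ) < N := by exact_mod_cast Nat.pos_of_ne_zero (NeZero.ne N)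
  have hF : 0 < Fsup m := lt_of_lt_of_le one_pos (one_le_Fsup hm)
  have hΦ0 : 0 ≤ Φ := (norm_nonneg _).trans (hΦ κ)
  have hCc0 : 0 ≤ Cc := (norm_nonneg _).trans hCc
  have hW : 0 ≤ ∏ i, wfold m i := Finset.prod_nonneg fun i _ => wfold_nonneg m i
  have hb0 := l1_nonneg b
  have hc0 := l1_nonneg c
  have h1 := norm_pw_sub_one_mul_pw_sub_one_le hre him (by linarith) hm b c
  have h2 := norm_Asol_border_le (D := d + 1) hre him hη hη4 hηD hm hΦ hCc κ
  set K := Real.sqrt 12 ^ (d + 1) * (Real.sqrt 6 * (1 + 8 * (d + 1 : ℕ))) with hK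
  set S := Real.sqrt (l1 b) * l1 c * Real.exp (η / N * (l1 b + l1 c)) with hS
  have hK0 : 0 ≤ K := by positivity
  have hS0 : 0 ≤ S := by positivity
  have hsN : Real.sqrt (N : ℝ) ≠ 0 := (Real.sqrt_pos.2 hN).ne'
  have hsF : Real.sqrt (Fsup m) ≠ 0 := (Real.sqrt_pos.2 hF).ne'
  -- `(10F/N)·√(10F/N) = 10√10·(F√F)/(N√N)`
  have hXX : 10 * Fsup m / N * Real.sqrt (10 * Fsup m / N) = 10 * Real.sqrt 10 * (Fsup m * Real.sqrt (Fsup m)) / ((N : ℝ) * Real.sqrt N) := by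
    rw [div_mul_sqrt_div (by positivity) hN, mul_mul_sqrt_mul (by norm_num) hF.le]
  rw [norm_mul]
  calc ‖(pw (kFine p m) b - 1) * (pw (kFine p m) c - 1)‖ *
        ‖Asol (dAl N p m) (dbAl N p m) (fun l => chiAl N p m * sbAl N p m l * φ l) (LAl N p m) (chiAl N p m * c₀) κ‖
      ≤ (4 * (10 * Fsup m / N * Real.sqrt (10 * Fsup m / N)) * (Real.sqrt (l1 b) * l1 c) * Real.exp (η / N * (l1 b + l1 c)))
          * (K * (N : ℝ) ^ 3 * (Φ / Fsup m ^ 2 + Cc / Fsup m ^ 3) * ∏ i, wfold m i) :=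
        mul_le_mul h1 h2 (norm_nonneg _) (by positivity)
    _ = 40 * Real.sqrt 10 * K * S * ((N : ℝ) * Real.sqrt N) * (Φ * (Real.sqrt (Fsup m) / Fsup m) + Cc * (Real.sqrt (Fsup m) / Fsup m ^ 2))
          * ∏ i, wfold m i := by
        rw [hXX, hS]
        have hNN2 : Real.sqrt (N : ℝ) ^ 2 = N := Real.sq_sqrt hN.le
        field_simp
        simp only [hNN2]
        ring

/-! ## §5 (U2‴): two differences on the minimiser column in the fibre -/

/-- [folklore] **(U2‴) — TWO DIFFERENCES GAIN EXACTLY `N^{−3/2}`, UNIFORMLY**: for the minimiser column `v = F_N(p)⁻¹ e_{(Q,l)}` under (U1)+A and every pair of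
integer steps `b, c`,
`‖Σ_m ampA p v m κ · (pw k_m b − 1)(pw k_m c − 1) · pw k_m (repZ z)‖ ≤ e^{(d+1)η}·A·(N^{d+2})⁻¹·(N·√N)⁻¹·(4·√‖b‖₁·‖c‖₁·e^{(η/N)(‖b‖₁+‖c‖₁)})·((π+1)√(π+1) + 10√10·K_D·(r₀²·C_{1/2} + r₀³·C_{−1/2}))`. -/
theorem norm_sum_ampA_diff2_pw_le (hre : ∀ i, |(p i).re| ≤ π) (him : ∀ i, |(p i).im| ≤ η) (hη : 0 ≤ η) (hη4 : η ≤ 1 / 4)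
    (hηD : (3 * (d + 1 : ℕ) / 2 + 2) * η ≤ 1 / 2)
    (hdet : (trigPolySymbol (stencil (d + 1)) (pieceMatrix (N := N)) p).det ≠ 0)
    {r : TorusSite (d + 1) N → ℝ} (hr : ∀ m, 0 < r m) {r0 : ℝ} (hr0 : 0 < r0) {A : ℝ} (hA0 : 0 ≤ A)
    (hU : IsUnit (arrowMat (scaledArrow N r r0 p))) (hA : ‖(arrowMat (scaledArrow N r r0 p))⁻¹‖ ≤ A)
    (l κ : Fin (d + 1)) (b c : Site (d + 1)) (z : TorusSite (d + 1) N) :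
    ‖∑ m : TorusSite (d + 1) N,
        ampA p (fun i => fibInv N i (Sum.inr (Sum.inr l)) p) m κ * ((pw (kFine p m) b - 1) * (pw (kFine p m) c - 1)) * pw (kFine p m) (repZ z)‖
      ≤ Real.exp ((d + 1) * η) * A * ((N : ℝ) ^ (d + 1 + 1))⁻¹ * ((N : ℝ) * Real.sqrt N)⁻¹ *
          (4 * (Real.sqrt (l1 b) * l1 c * Real.exp (η / N * (l1 b + l1 c)))) *
          ((π + 1) * Real.sqrt (π + 1) + 10 * Real.sqrt 10 * (Real.sqrt 12 ^ (d + 1) * (Real.sqrt 6 * (1 + 8 * (d + 1 : ℕ)))) *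
            (r0 ^ 2 * ((3 * π) ^ (1 - (1 / 2 : ℝ)) * (3 : ℝ) ^ (d + 1) * aliasConst (d + 1) (1 / 2))
              + r0 ^ 3 * ((3 * π) ^ (1 - (-(1 / 2) : ℝ)) * (3 : ℝ) ^ (d + 1) * aliasConst (d + 1) (-(1 / 2))))) := by
  classical
  set v : Idx (d + 1) N → ℂ := fun i => fibInv N i (Sum.inr (Sum.inr l)) p with hv
  set B : ℝ := A * ((N : ℝ) ^ (d + 1 + 1))⁻¹ with hB
  set K : ℝ := Real.sqrt 12 ^ (d + 1) * (Real.sqrt 6 * (1 + 8 * (d + 1 : ℕ))) with hK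
  set C0 : ℝ := (3 * π) ^ (1 - (1 / 2 : ℝ)) * (3 : ℝ) ^ (d + 1) * aliasConst (d + 1) (1 / 2) with hC0
  set C1 : ℝ := (3 * π) ^ (1 - (-(1 / 2) : ℝ)) * (3 : ℝ) ^ (d + 1) * aliasConst (d + 1) (-(1 / 2)) with hC1
  set E : ℝ := Real.exp ((d + 1) * η) with hE
  set S : ℝ := Real.sqrt (l1 b) * l1 c * Real.exp (η / N * (l1 b + l1 c)) with hS
  have hN : (0 : ℝ) < N := by exact_mod_cast Nat.pos_of_ne_zero (NeZero.ne N)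
  have hsN : 0 < Real.sqrt (N : ℝ) := Real.sqrt_pos.2 hN
  have hNN2 : Real.sqrt (N : ℝ) ^ 2 = N := Real.sq_sqrt hN.le
  have hb0 := l1_nonneg b
  have hc0 := l1_nonneg c
  have hB0 : 0 ≤ B := by positivity
  have hK0 : 0 ≤ K := by positivity
  have hE0 : 0 ≤ E := (Real.exp_pos _).le
  have hS0 : 0 ≤ S := by positivity
  obtain ⟨c₀, hx, hAmp, hφ, hc⟩ := column_apriori hr hr0 p hA0 hdet hU hA l
  set Φ : ℝ := r0 ^ 2 / (N : ℝ) ^ 3 * A * ((N : ℝ) ^ (d + 1 + 1))⁻¹ with hΦ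
  set Cc : ℝ := r0 ^ 3 / (N : ℝ) ^ 3 * A * ((N : ℝ) ^ (d + 1 + 1))⁻¹ with hCc
  have hΦ' : ∀ κ', ‖v (Sum.inr (Sum.inr κ'))‖ ≤ Φ := fun κ' => hφ κ'
  -- zero alias
  have hterm0 : ‖ampA p v 0 κ * ((pw (kFine p (0 : TorusSite (d + 1) N)) b - 1) * (pw (kFine p (0 : TorusSite (d + 1) N)) c - 1))
        * pw (kFine p (0 : TorusSite (d + 1) N)) (repZ z)‖
      ≤ E * (B * (((N : ℝ) * Real.sqrt N)⁻¹ * (4 * S) * ((π + 1) * Real.sqrt (π + 1)))) := by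
    rw [norm_mul, norm_mul]
    have h0 := hAmp 0 κ
    have hd := norm_pw_sub_one_mul_pw_sub_one_zero_le (N := N) hre him (by linarith) b c
    have hXX : (π + 1) / N * Real.sqrt ((π + 1) / N) = (π + 1) * Real.sqrt (π + 1) / ((N : ℝ) * Real.sqrt N) :=
      div_mul_sqrt_div (by positivity) hN
    rw [hXX] at hd
    have hp := norm_pw_repZ_le him (0 : TorusSite (d + 1) N) z
    calc ‖ampA p v 0 κ‖ * ‖(pw (kFine p (0 : TorusSite (d + 1) N)) b - 1) * (pw (kFine p (0 : TorusSite (d + 1) N)) c - 1)‖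
          * ‖pw (kFine p (0 : TorusSite (d + 1) N)) (repZ z)‖
        ≤ (B * (4 * ((π + 1) * Real.sqrt (π + 1) / ((N : ℝ) * Real.sqrt N)) * (Real.sqrt (l1 b) * l1 c) * Real.exp (η / N * (l1 b + l1 c)))) * E :=
          mul_le_mul (mul_le_mul h0 hd (norm_nonneg _) hB0) hp (norm_nonneg _) (by positivity)
      _ = E * (B * (((N : ℝ) * Real.sqrt N)⁻¹ * (4 * S) * ((π + 1) * Real.sqrt (π + 1)))) := by rw [hS]; field_simp
  -- nonzero aliases
  have hterm : ∀ m : TorusSite (d + 1) N, m ≠ 0 →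
      ‖ampA p v m κ * ((pw (kFine p m) b - 1) * (pw (kFine p m) c - 1)) * pw (kFine p m) (repZ z)‖
        ≤ E * (B * ((N : ℝ) * Real.sqrt N)⁻¹ * (4 * S) * (10 * Real.sqrt 10 * K) *
            (r0 ^ 2 * pointWeight (1 / 2) (srep m) + r0 ^ 3 * pointWeight (-(1 / 2)) (srep m))) := by
    intro m hm
    have hLm : FibreSymbols.lapSym (kFine p m) ≠ 0 := by
      have hpos := lapR_pos (N := N) (p := p) hre hm
      have hhalf := half_lapR_le_norm_LAl (N := N) hre him hη hηD hm
      intro h0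
      have : ‖LAl N p m‖ = 0 := by rw [show LAl N p m = FibreSymbols.lapSym (kFine p m) from rfl, h0, norm_zero]
      linarith
    have hF : 0 < Fsup m := lt_of_lt_of_le one_pos (one_le_Fsup hm)
    have hcurl := norm_diff2_mul_Asol_border_le hre him hη hη4 hηD hm (φ := fun κ' => v (Sum.inr (Sum.inr κ'))) (c₀ := c₀) hΦ' hc κ b c
    rw [← ampA_eq_Asol hx m hLm, ← hK, ← hS] at hcurl
    have hre' : 40 * Real.sqrt 10 * K * S * ((N : ℝ) * Real.sqrt N) *
          (Φ * (Real.sqrt (Fsup m) / Fsup m) + Cc * (Real.sqrt (Fsup m) / Fsup m ^ 2)) * ∏ i, wfold m i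
        = B * ((N : ℝ) * Real.sqrt N)⁻¹ * (4 * S) * (10 * Real.sqrt 10 * K) *
            (r0 ^ 2 * pointWeight (1 / 2) (srep m) + r0 ^ 3 * pointWeight (-(1 / 2)) (srep m)) := by
      rw [← pointWeight_half_eq hm, ← pointWeight_neg_half_eq hm, hΦ, hCc, hB]
      field_simp
      simp only [hNN2]
      ring
    rw [hre'] at hcurl
    rw [norm_mul, show ampA p v m κ * ((pw (kFine p m) b - 1) * (pw (kFine p m) c - 1))
        = (pw (kFine p m) b - 1) * (pw (kFine p m) c - 1) * ampA p v m κ from mul_comm _ _]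
    have h1 := pointWeight_nonneg (1 / 2 : ℝ) (srep m)
    have h2 := pointWeight_nonneg (-(1 / 2) : ℝ) (srep m)
    calc ‖(pw (kFine p m) b - 1) * (pw (kFine p m) c - 1) * ampA p v m κ‖ * ‖pw (kFine p m) (repZ z)‖
        ≤ (B * ((N : ℝ) * Real.sqrt N)⁻¹ * (4 * S) * (10 * Real.sqrt 10 * K) *
            (r0 ^ 2 * pointWeight (1 / 2) (srep m) + r0 ^ 3 * pointWeight (-(1 / 2)) (srep m))) * E :=
          mul_le_mul hcurl (norm_pw_repZ_le him m z) (norm_nonneg _) (by positivity)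
      _ = _ := mul_comm _ _
  -- split and sum
  have hS0' := sum_pointWeight_srep_le (D := d + 1) (N := N) (Nat.succ_pos d) (α := (1 / 2 : ℝ)) (by norm_num)
  have hS1' := sum_pointWeight_srep_le (D := d + 1) (N := N) (Nat.succ_pos d) (α := (-(1 / 2) : ℝ)) (by norm_num)
  have hsplit : ‖∑ m : TorusSite (d + 1) N, ampA p v m κ * ((pw (kFine p m) b - 1) * (pw (kFine p m) c - 1)) * pw (kFine p m) (repZ z)‖
      ≤ E * (B * (((N : ℝ) * Real.sqrt N)⁻¹ * (4 * S) * ((π + 1) * Real.sqrt (π + 1))))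
        + ∑ m ∈ (Finset.univ : Finset (TorusSite (d + 1) N)).filter (fun m => m ≠ 0),
          E * (B * ((N : ℝ) * Real.sqrt N)⁻¹ * (4 * S) * (10 * Real.sqrt 10 * K) *
            (r0 ^ 2 * pointWeight (1 / 2) (srep m) + r0 ^ 3 * pointWeight (-(1 / 2)) (srep m))) := by
    refine (norm_sum_le _ _).trans ?_
    rw [← Finset.add_sum_erase _ _ (Finset.mem_univ (0 : TorusSite (d + 1) N))]
    refine add_le_add hterm0 ?_
    have hset : (Finset.univ : Finset (TorusSite (d + 1) N)).erase 0 = Finset.univ.filter (fun m => m ≠ 0) := by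
      ext m; simp [Finset.mem_erase]
    rw [hset]
    exact Finset.sum_le_sum fun m hm => hterm m (Finset.mem_filter.1 hm).2
  have hsum : ∑ m ∈ (Finset.univ : Finset (TorusSite (d + 1) N)).filter (fun m => m ≠ 0),
      E * (B * ((N : ℝ) * Real.sqrt N)⁻¹ * (4 * S) * (10 * Real.sqrt 10 * K) *
        (r0 ^ 2 * pointWeight (1 / 2) (srep m) + r0 ^ 3 * pointWeight (-(1 / 2)) (srep m)))
      ≤ E * (B * ((N : ℝ) * Real.sqrt N)⁻¹ * (4 * S) * (10 * Real.sqrt 10 * K) * (r0 ^ 2 * C0 + r0 ^ 3 * C1)) := by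
    rw [← Finset.mul_sum, ← Finset.mul_sum, Finset.sum_add_distrib, ← Finset.mul_sum, ← Finset.mul_sum]
    apply mul_le_mul_of_nonneg_left _ hE0
    apply mul_le_mul_of_nonneg_left _ (by positivity)
    exact add_le_add (mul_le_mul_of_nonneg_left hS0' (by positivity)) (mul_le_mul_of_nonneg_left hS1' (by positivity))
  calc _ ≤ E * (B * (((N : ℝ) * Real.sqrt N)⁻¹ * (4 * S) * ((π + 1) * Real.sqrt (π + 1))))
        + E * (B * ((N : ℝ) * Real.sqrt N)⁻¹ * (4 * S) * (10 * Real.sqrt 10 * K) * (r0 ^ 2 * C0 + r0 ^ 3 * C1)) :=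
        hsplit.trans (add_le_add le_rfl hsum)
    _ = E * A * ((N : ℝ) ^ (d + 1 + 1))⁻¹ * ((N : ℝ) * Real.sqrt N)⁻¹ * (4 * S) *
          ((π + 1) * Real.sqrt (π + 1) + 10 * Real.sqrt 10 * K * (r0 ^ 2 * C0 + r0 ^ 3 * C1)) := by
        rw [hB]; ring

end Summit.QuantumFields.BalabanUV.Beta.GAN24.FineReadoutSecondDiff

end
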